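import Literature.AnabelianGeometry.SemiGraphs.SpecialFibreTowerOfCoveringsVertexFibres
import HarnessLib

/-!
# [SemiAnbd] Example 3.10: the ACTION of `Δ = π₁^temp(𝒢)` on the vertices of the fibres `𝒢_i` of the special-fibre
# tower, as a homomorphism `Δ → Perm(𝔾_i)` through `Δ/N_i`, with orbits the fibres over `𝔾`

Mochizuki, *Semi-graphs of anabelioids*, Publ. RIMS **42** (2006), §3, Example 3.10, manuscript p. 44 l. 12–17
[cite: MochizukiSemiAnbd2006, Ex 3.10 p.44] ("semi-graphs of anabelioids `𝒢_i`, `𝒢^c_i` on which `Δ_i` acts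
faithfully"); S. Mochizuki, *Inter-universal Teichmüller theory I*, proof of Prop. 2.4 (i) p. 50 l. 27–30 (the action
of `Π^tp_X` on the special fibre `𝔾_J` of `X_J` through `Π^tp_X/J`) [cite: Mochizuki2012, Prop 2.4(i) p.50].

PROOF-ONLY sequel (abc-iut cell, layer L3, seat abc-iut-L3-t2 gen 5, row «Ex310-VERTEX-FIBRES» part C) of
`SpecialFibreTowerOfCoveringsVertexFibres.lean`: its clauses (V5) (existence and uniqueness of `g · ṽ`, transitivity)
and (V4) (`N_i`-classes) are packaged into a HOMOMORPHISM `σ_i : Δ →* Equiv.Perm (vertices of 𝔾_i)` — the vertex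
part of the action "`Δ_i = Δ/N_i` acts on `𝒢_i`" — with: `proj ∘ σ_i(g) = proj` (over `𝔾`), the dictionary law
(conjugation by `g` carries the `N_i`-class of verticial subgroups attached to `ṽ` to the class attached to
`σ_i(g) ṽ`), `N_i ≤ ker σ_i`, and TRANSITIVITY of `Δ` on every fibre `proj⁻¹(v)` — i.e. `𝔾 = 𝔾_i / Δ` on vertices.
This is the vertex law `actGraph_vertexMap` of the origin record `SpecialFibreTower.PiData` (item (P2)) realised as a
THEOREM at the genuine fibres `𝒢_{S_i}` (no one-vertex degeneration).  No definition (the action is delivered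
existentially), no instance, no new named fact; vertices only; nothing here is about curves; no side is taken on
[IUTchIII] Cor. 3.12.
-/

noncomputable section

open CategoryTheory Topology

namespace Literature.AnabelianGeometry.SemiGraphs

open Literature.AlgebraicGeometry.Frobenioids (IsConnectedObj)
open ProfiniteSemiGraph

universe u

/-- `(g h) K (g h)⁻¹ = g (h K h⁻¹) g⁻¹`. [folklore] -/
private theorem subgroup_map_conj_mul {G : Type u} [Group G] (K : Subgroup G) (g h : G) :
    K.map (MulAut.conj (g * h)).toMonoidHom =
      (K.map (MulAut.conj h).toMonoidHom).map (MulAut.conj g).toMonoidHom := by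
  rw [Subgroup.map_map, map_mul]
  rfl

/-- `1 K 1⁻¹ = K`. [folklore] -/
private theorem subgroup_map_conj_one {G : Type u} [Group G] (K : Subgroup G) :
    K.map (MulAut.conj (1 : G)).toMonoidHom = K := by
  rw [map_one]
  exact K.map_id

namespace SpecialFibreTower

variable {𝒢 : ProfiniteSemiGraph.{u}}

/-- **[SemiAnbd] Example 3.10 — the action of `Δ = π₁^temp(𝒢)` on the VERTICES of the fibres `𝒢_i`.**  For `𝒢` with
the hypotheses of Thm. 3.7 and strictly coherent, a chart `c` and printed level data `N`: the Ex. 3.10 tower `T` over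
`π₁^temp(𝒢)` (`T.N = N`, `T.admKer i = 1`, fibres the covering semi-graphs of anabelioids `𝒢_{S_i}`) carries, for
every `i`, the vertex map `proj : 𝔾_i → 𝔾` and a homomorphism `σ : Δ →* Equiv.Perm (vertices of 𝔾_i)` such that:
`proj (σ g ṽ) = proj ṽ`; the DICTIONARY LAW — for `K` verticial at `proj ṽ` whose trace `T.adm i (N_i ∩ K)` is
verticial at `ṽ`, the trace of `gKg⁻¹` is verticial at `σ g ṽ` (so `σ` is the vertex action DERIVED from
conjugation, as in `SpecialFibreTower.actVertex`); `Δ` is TRANSITIVE on every fibre of `proj`; and `N_i` acts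
trivially (`σ` factors through `Δ_i = Δ/N_i`); together with (V0)–(V2) of the fibre dictionary.
[cite: MochizukiSemiAnbd2006, Ex 3.10 p.44] -/
theorem exists_of_coverings_vertexAction (h37 : 𝒢.Thm37Hypotheses) (hsc : 𝒢.IsStrictlyCoherent)
    (c : TemperedPiChart 𝒢) (N : ℕ → Subgroup c.G) (hanti : Antitone N) (hopen : ∀ i, IsOpen (N i : Set c.G))
    (hchar : ∀ (i) (φ : c.G ≃ₜ* c.G), (N i).map φ.toMulEquiv.toMonoidHom = N i)
    (hnormal : ∀ i, (N i).Normal) (hfi : ∀ i, (N i).FiniteIndex) (hexh : ∀ g : c.G, (∀ i, g ∈ N i) → g = 1) :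
    ∃ T : SpecialFibreTower c.G, T.N = N ∧ (∀ i, T.admKer i = ⊥) ∧
      ∀ i, ∃ (S : CovObj 𝒢) (hS : S.IsTempered) (_ : T.Gc i = S.coveringGraph)
        (proj : (T.Gc i).graph.Vertex → 𝒢.graph.Vertex) (σ : c.G →* Equiv.Perm (T.Gc i).graph.Vertex),
        IsConnectedObj (⟨S, hS⟩ : BTempCat 𝒢) ∧
        Function.Surjective proj ∧
        -- (V1)/(V2): the verticial subgroups of the fibre are the images of the traces
        (∀ x, ∃ K ∈ verticialSubgroups c (proj x),
          (K.subgroupOf (T.N i)).map (T.adm i).toMonoidHom ∈ verticialSubgroups (T.chart i) x) ∧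
        (∀ x (H : Subgroup (T.chart i).G), H ∈ verticialSubgroups (T.chart i) x →
          ∃ K ∈ verticialSubgroups c (proj x), H = (K.subgroupOf (T.N i)).map (T.adm i).toMonoidHom) ∧
        -- the action lies over `𝔾`
        (∀ g x, proj (σ g x) = proj x) ∧
        -- the dictionary law: `σ` is induced by conjugation
        (∀ g x (K : Subgroup c.G), K ∈ verticialSubgroups c (proj x) →
          (K.subgroupOf (T.N i)).map (T.adm i).toMonoidHom ∈ verticialSubgroups (T.chart i) x →
          ((K.map (MulAut.conj g).toMonoidHom).subgroupOf (T.N i)).map (T.adm i).toMonoidHom ∈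
            verticialSubgroups (T.chart i) (σ g x)) ∧
        -- transitivity on the fibres of `proj`
        (∀ x₁ x₂, proj x₁ = proj x₂ → ∃ g, σ g x₁ = x₂) ∧
        -- `N_i` acts trivially
        (∀ n ∈ T.N i, σ n = 1) := by
  obtain ⟨T, hTN, hadm, hfib⟩ := exists_of_coverings_vertexFibres h37 hsc c N hanti hopen hchar hnormal hfi hexh
  refine ⟨T, hTN, hadm, fun i => ?_⟩
  obtain ⟨S, hS, hGc, proj, hSc, hsurj, hV1, hV2, -, hV4, hV5, hV5t⟩ := hfib i
  -- the action on vertices, by choice from (V5)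
  let f : c.G → (T.Gc i).graph.Vertex → (T.Gc i).graph.Vertex := fun g x => (hV5 g x).exists.choose
  have hf : ∀ g x, proj (f g x) = proj x ∧ ∀ K ∈ verticialSubgroups c (proj x),
      (K.subgroupOf (T.N i)).map (T.adm i).toMonoidHom ∈ verticialSubgroups (T.chart i) x →
      ((K.map (MulAut.conj g).toMonoidHom).subgroupOf (T.N i)).map (T.adm i).toMonoidHom ∈
        verticialSubgroups (T.chart i) (f g x) := fun g x => (hV5 g x).exists.choose_spec
  have huniq : ∀ g x w, proj w = proj x → (∀ K ∈ verticialSubgroups c (proj x),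
      (K.subgroupOf (T.N i)).map (T.adm i).toMonoidHom ∈ verticialSubgroups (T.chart i) x →
      ((K.map (MulAut.conj g).toMonoidHom).subgroupOf (T.N i)).map (T.adm i).toMonoidHom ∈
        verticialSubgroups (T.chart i) w) → w = f g x :=
    fun g x w hw hK => (hV5 g x).unique ⟨hw, hK⟩ (hf g x)
  -- `f 1 = id`
  have hf1 : ∀ x, f 1 x = x := fun x => by
    refine (huniq 1 x x rfl fun K _ hKx => ?_).symm
    rw [subgroup_map_conj_one]; exact hKx
  -- `f (g h) = f g ∘ f h`
  have hfmul : ∀ g h x, f (g * h) x = f g (f h x) := fun g h x => by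
    refine (huniq (g * h) x (f g (f h x)) ?_ fun K hK hKx => ?_).symm
    · rw [(hf g _).1, (hf h x).1]
    · rw [subgroup_map_conj_mul]
      refine (hf g (f h x)).2 _ ?_ ((hf h x).2 K hK hKx)
      rw [(hf h x).1]
      exact conj_mem_verticialSubgroups c hK h
  -- the homomorphism
  let σ : c.G →* Equiv.Perm (T.Gc i).graph.Vertex :=
    { toFun := fun g =>
        { toFun := f g
          invFun := f g⁻¹
          left_inv := fun x => by rw [← hfmul, inv_mul_cancel, hf1]
          right_inv := fun x => by rw [← hfmul, mul_inv_cancel, hf1] }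
      map_one' := Equiv.ext fun x => hf1 x
      map_mul' := fun g h => Equiv.ext fun x => hfmul g h x }
  have hσ : ∀ g x, σ g x = f g x := fun _ _ => rfl
  refine ⟨S, hS, hGc, proj, σ, hSc, hsurj, hV1, hV2, fun g x => (hf g x).1,
    fun g x K hK hKx => (hf g x).2 K hK hKx, fun x₁ x₂ h12 => ?_, fun n hn => ?_⟩
  · -- transitivity
    obtain ⟨g, hg⟩ := hV5t x₁ x₂ h12
    exact ⟨g, (huniq g x₁ x₂ h12.symm hg).symm⟩
  · -- `N_i` acts trivially: `x` itself receives the `n`-conjugates of its class (V4)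
    refine Equiv.ext fun x => ?_
    rw [hσ, Equiv.Perm.coe_one, id_eq]
    refine (huniq n x x rfl fun K hK hKx => ?_).symm
    exact ((hV4 (proj x) x K (K.map (MulAut.conj n).toMonoidHom) hK (conj_mem_verticialSubgroups c hK n)
      hKx).2 ⟨n, hn, rfl⟩)

end SpecialFibreTower

end Literature.AnabelianGeometry.SemiGraphs

end
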